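import Summits.HodgeConjecture.CorCM.Census.CentralSquaresMixedFaceCoords
import Summits.HodgeConjecture.CorCM.Census.CentralSquaresOrderFourClosure
import Summits.HodgeConjecture.CorCM.Census.CentralSquaresBaseInvolutive

/-!
# The square-central class, XXX: the order-`4` swap frame — residual closure up to `4` from the mixed designated face

COR-CM (cell `pub-hodgecm2`), count-neutral kernel combinatorics by the binder seat b09 (gen 46; lane SQUARE-CENTRAL CLASS, part XXX), assembling parts XXV
(`rel_transversal_mem'`, `relc_mem'`), XXVII (`Y_sub_Y'_mem_of_mixed_face`), XXVIII (`mapDomain_rt_Y_of_swap/_of_stab/_of_stab_stab`, `four_smul_mem_of_relations`,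
`residual_closure_frame_four`) BY NAME.  Theorems only: no definition, no `decide`, no certificate, no named fact, no `sorry`.  HONEST FRAMING: `HC_CM` is
NOT proved, here or anywhere in the tree; nothing here is a period or a headline.

THE ORDER-`4` SWAP FRAME (`ℤ/4 ⋊ ℤ/4` with `c = a²` or `a²y²`; design note `CENTRAL-SQUARES-M2.md` §5).  The one new relation `Y_h − Y'_{κ₁}`
(`κ₁ = h·g₁⁻¹`) and its translates along `g₁` (`Y_{h''} − Y'_{κ₁}`), `g₁²` (`Y_{h''} − Y'_{κ₂}`) and `Q` (`Y_{t₁} + Y'_{a₁}`, `Y_{t₂} + Y'_{a₁}`, `Y_{t₂} + Y'_{a₂}`),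
together with the two transversal relations on each side (`R(T)`, `R(𝓗 ∖ T)`, `Rᶜ(A)`, `Rᶜ(𝓗ᶜ ∖ A)` — part XXV, base-involutive swap), give `4Y_s`, `4Y'_s` for
all eight places and hence the residual closure up to `4` (`residual_closure_order_four`).  The place relations (which representative of `T₀` carries the
place of `h·g₁⁻²`, `h·Q⁻¹`, …) are hypotheses; in the rows they are read off `π : G ↠ D₄` (part XXXI).  What remains for the law `μ = φ₂` is part XIIIʼs
chosen cover with the three prescribed blocks (part XXIX `exists_admissible_choice₃`) — part XXXI.

## References
* [Pohlmann1968] H. Pohlmann, Algebraic cycles on abelian varieties of complex multiplication type, Ann. of Math. 88 (1968), Thm 1.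
-/

namespace Summit.HodgeConjecture.CorCM.Census.CentralSquares

open Finset
open scoped symmDiff
open Summit.HodgeConjecture.CorCM.Prior.AllgGroup.RfwfAllgGroup
open Summit.HodgeConjecture.CorCM.Census.BlockParity
open Summit.HodgeConjecture.CorCM.Census.Coinvariant
open Summit.HodgeConjecture.CorCM.Census.TwistGeneration
open Summit.HodgeConjecture.CorCM.Census.BaseBlock
open Summit.HodgeConjecture.CorCM.Census.CoverClosure

noncomputable section

variable {G : Type*} [Group G] [Fintype G] [DecidableEq G] (c : G)

section Frame

variable (hc2 : c * c = 1) (hcen : ∀ x : G, x * c = c * x) (T₀ T₁ : CMF G c)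
variable (hbase : ∀ Q : G, rt c Q T₀ = T₀ ∨ rt c Q T₀ = rt c c T₀ ∨ rt c Q T₀ = T₁ ∨ rt c Q T₀ = rt c c T₁)
variable (m : ℕ) (hn : T₀.1.card = 4 * m) (hH : (T₀.1 \ T₁.1).card = 2 * m)
variable (Q : G) (hQ : rt c Q T₀ = T₁) (hQ₁ : rt c Q T₁ = T₀)
variable (hσH : ∀ t ∈ T₀.1, ∀ t' ∈ T₀.1, (t' = t * Q ∨ t' = c * (t * Q)) → (t ∈ T₀.1 \ T₁.1 ↔ t' ∈ T₀.1 \ T₁.1))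
variable (L : Submodule ℤ (CMF G c →₀ ℤ)) (hLrt : ∀ (Q' : G) (y : CMF G c →₀ ℤ), y ∈ L → Finsupp.mapDomain (rt c Q') y ∈ L)
variable (hcover : ∀ Ψ : CMF G c, 2 ≤ bpot c T₀ Ψ → ∃ Q₂ s s' : G, bpot c T₀ Ψ = ddist (rt c Q₂ T₀) Ψ ∧
    s ∈ (rt c Q₂ T₀).1 \ Ψ.1 ∧ s' ∈ (rt c Q₂ T₀).1 \ Ψ.1 ∧ s ≠ s' ∧
    gface c hc2 Ψ s s' ∈ L ∧
    ((∃ Q₁ t t' : G, bpot c T₀ Ψ = ddist (rt c Q₁ T₀) Ψ ∧ t ∈ (rt c Q₁ T₀).1 \ Ψ.1 ∧ t' ∈ (rt c Q₁ T₀).1 \ Ψ.1 ∧ t ≠ t' ∧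
        (∀ Q' : G, ddist (rt c Q' T₀) (oflipCM c hc2 t Ψ) = bpot c T₀ (oflipCM c hc2 t Ψ) → rt c Q' T₀ = rt c Q₁ T₀) ∧
        (∀ Q' : G, ddist (rt c Q' T₀) (oflipCM c hc2 t' Ψ) = bpot c T₀ (oflipCM c hc2 t' Ψ) → rt c Q' T₀ = rt c Q₁ T₀) ∧
        (∀ Q' : G, ddist (rt c Q' T₀) (oflipCM c hc2 t (oflipCM c hc2 t' Ψ)) = bpot c T₀ (oflipCM c hc2 t (oflipCM c hc2 t' Ψ)) →
          rt c Q' T₀ = rt c Q₁ T₀)) →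
      (∀ Q' : G, ddist (rt c Q' T₀) (oflipCM c hc2 s Ψ) = bpot c T₀ (oflipCM c hc2 s Ψ) → rt c Q' T₀ = rt c Q₂ T₀) ∧
      (∀ Q' : G, ddist (rt c Q' T₀) (oflipCM c hc2 s' Ψ) = bpot c T₀ (oflipCM c hc2 s' Ψ) → rt c Q' T₀ = rt c Q₂ T₀) ∧
      (∀ Q' : G, ddist (rt c Q' T₀) (oflipCM c hc2 s (oflipCM c hc2 s' Ψ)) = bpot c T₀ (oflipCM c hc2 s (oflipCM c hc2 s' Ψ)) →
        rt c Q' T₀ = rt c Q₂ T₀)))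

/-! ## §1 The six translates and the closure up to `4` -/

include hcen hbase hn hH hQ hQ₁ hσH hLrt hcover in
/-- **RESIDUAL CLOSURE UP TO `4` FROM THE MIXED DESIGNATED FACE** (`m = 2`, order-`4` swap frame).  Frame: base block `{T₀, T̄₀, T₁, T̄₁}`, `|T₀| = 8`,
`𝓗 = T₀ ∖ T₁ = {t₁, t₂, h, h''}` with `T = {t₁, t₂}` a transversal of the swap `Q` (`T₀·Q⁻¹ = T₁`, `T₁·Q⁻¹ = T₀`, place permutation preserving `𝓗`),
`𝓗ᶜ = T₀ ∩ T₁ = A ⊔ {κ₁, κ₂}` with `A = {a₁, a₂} ∋ k` a transversal; `Φ` the type with `D(Φ) = T ∪ A`; `g₁` with `T₀·g₁⁻¹ = T₀`, `T₁·g₁⁻¹ = T̄₁`,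
`Φ·g₁⁻¹ = Φ`, `κ₁ = h·g₁⁻¹`, and the place relations `h·g₁⁻² ∼ h''`, `h·g₁⁻³ ∼ κ₂`, `h·Q⁻¹ ∼ t₁`, `h''·Q⁻¹ ∼ t₂`, `κ₁·Q⁻¹ ∼ a₁`, `κ₂·Q⁻¹ ∼ a₂`
(`x ∼ y`: `x = y` or `x = c·y`).  If the base-change stable lattice `L ⊇ ℤ⟨pairs⟩` of a strict lowering cover contains the mixed face of `Φ` at the
places of `k, h`, the face of `Φ^{(k)}` at the places `h, h''` and the face of `Φ^{(h)}` at the places `κ₁, κ₂`, then `4·y ∈ L` for every residual Hodge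
vector `y` of the base block. [folklore] -/
theorem residual_closure_order_four (hc1 : c ≠ 1) (hP : ∀ Ψ : CMF G c, pair c Ψ ∈ L) (hm : m = 2)
    (T A : Finset G) (hTH : T ⊆ T₀.1 \ T₁.1) (hA : A ⊆ T₀.1 ∩ T₁.1)
    (hT : ∀ t ∈ T₀.1 \ T₁.1, ∀ t' ∈ T₀.1, (t' = t * Q ∨ t' = c * (t * Q)) → (t ∈ T ↔ t' ∉ T))
    (hAtr : ∀ t ∈ T₀.1 ∩ T₁.1, ∀ t' ∈ T₀.1, (t' = t * Q ∨ t' = c * (t * Q)) → (t ∈ A ↔ t' ∉ A))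
    {t₁ t₂ : G} (hTe : T = {t₁, t₂}) (ht₁₂ : t₁ ≠ t₂)
    (Φ : CMF G c) (hΦ : T₀.1 \ Φ.1 = T ∪ A)
    {k k'' : G} (hAe : A = {k, k''}) (hkk'' : k ≠ k'')
    {h h'' : G} (hHe : (T₀.1 \ T₁.1) \ T = {h, h''}) (hhh'' : h ≠ h'')
    (g₁ : G) (hg₀ : rt c g₁ T₀ = T₀) (hg₁ : rt c g₁ T₁ = rt c c T₁) (hgΦ : rt c g₁ Φ = Φ)
    {κ₂ : G} (hAce : (T₀.1 ∩ T₁.1) \ A = {h * g₁⁻¹, κ₂}) (hκ₁₂ : h * g₁⁻¹ ≠ κ₂)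
    {a₁ a₂ : G} (ha₁A : a₁ ∈ A) (ha₂A : a₂ ∈ A) (ha₁₂ : a₁ ≠ a₂)
    (hζh : h * g₁⁻¹ * g₁⁻¹ = h'' ∨ h * g₁⁻¹ * g₁⁻¹ = c * h'')
    (hζκ : h * g₁⁻¹ * g₁⁻¹ * g₁⁻¹ = κ₂ ∨ h * g₁⁻¹ * g₁⁻¹ * g₁⁻¹ = c * κ₂)
    (hσh : h * Q⁻¹ = t₁ ∨ h * Q⁻¹ = c * t₁) (hσh'' : h'' * Q⁻¹ = t₂ ∨ h'' * Q⁻¹ = c * t₂)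
    (hσκ₁ : h * g₁⁻¹ * Q⁻¹ = a₁ ∨ h * g₁⁻¹ * Q⁻¹ = c * a₁) (hσκ₂ : κ₂ * Q⁻¹ = a₂ ∨ κ₂ * Q⁻¹ = c * a₂)
    (hF : gface c hc2 Φ k h ∈ L) (hFk : gface c hc2 (oflipCM c hc2 k Φ) h h'' ∈ L)
    (hFh : gface c hc2 (oflipCM c hc2 h Φ) (h * g₁⁻¹) κ₂ ∈ L) :
    ∀ y ∈ hodgeSpan c hc2, (∀ Ψ ∈ y.support, bpot c T₀ Ψ ≤ 1) → ((2 : ℤ) ^ 2) • y ∈ L := by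
  have hm2 : 2 ≤ m := by omega
  have hcinv : c⁻¹ = c := inv_eq_of_mul_eq_one_right hc2
  -- flips at `x` and at `c·x` agree: normalise the place relations
  have hnorm : ∀ {x y : G} (X : CMF G c), (x = y ∨ x = c * y) → oflipCM c hc2 x X = oflipCM c hc2 y X := by
    intro x y X hxy
    rcases hxy with rfl | rfl
    · rfl
    · exact oflipCM_cmul c hc2 y X
  -- (r1) the stabiliser relation in coordinates
  have r1 : ((Finsupp.single (oflipCM c hc2 h T₀) (1 : ℤ) - Finsupp.single T₀ (1 : ℤ)) + (Finsupp.single (oflipCM c hc2 h T₁) (1 : ℤ) - Finsupp.single T₁ (1 : ℤ))) -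
        ((Finsupp.single (oflipCM c hc2 (h * g₁⁻¹) T₀) (1 : ℤ) - Finsupp.single T₀ (1 : ℤ)) - (Finsupp.single (oflipCM c hc2 (h * g₁⁻¹) T₁) (1 : ℤ) - Finsupp.single T₁ (1 : ℤ))) ∈ L :=
    Y_sub_Y'_mem_of_mixed_face c hc2 hcen T₀ T₁ hbase m hn hH Q hQ L hLrt hcover hP hm T A hTH hA Φ hΦ hAe hkk'' hHe hhh'' hAce hκ₁₂ hF hFk hFh
      g₁ hg₀ hg₁ hgΦ
  -- (r3) its translate by `g₁`: `Y_{h''} − Y'_{κ₁}`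
  have r3 : ((Finsupp.single (oflipCM c hc2 h'' T₀) (1 : ℤ) - Finsupp.single T₀ (1 : ℤ)) + (Finsupp.single (oflipCM c hc2 h'' T₁) (1 : ℤ) - Finsupp.single T₁ (1 : ℤ))) -
        ((Finsupp.single (oflipCM c hc2 (h * g₁⁻¹) T₀) (1 : ℤ) - Finsupp.single T₀ (1 : ℤ)) - (Finsupp.single (oflipCM c hc2 (h * g₁⁻¹) T₁) (1 : ℤ) - Finsupp.single T₁ (1 : ℤ))) ∈ L := by
    have h1 := hLrt g₁ _ r1
    rw [Finsupp.mapDomain_sub, mapDomain_rt_Y_of_stab c hc2 hcen T₀ T₁ g₁ hg₀ hg₁, mapDomain_rt_Y'_of_stab c hc2 hcen T₀ T₁ g₁ hg₀ hg₁,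
      hnorm T₀ hζh, hnorm T₁ hζh] at h1
    -- h1 : (Y'_κ₁ + (pair T₁^κ₁ − pair T₁)) − (Y_{h''} − (pair T₁^{h''} − pair T₁)) ∈ L
    have hp : (pair c (oflipCM c hc2 (h * g₁⁻¹) T₁) - pair c T₁) + (pair c (oflipCM c hc2 h'' T₁) - pair c T₁) ∈ L :=
      Submodule.add_mem _ (Submodule.sub_mem _ (hP _) (hP _)) (Submodule.sub_mem _ (hP _) (hP _))
    have h2 := Submodule.sub_mem _ hp h1
    have e : ((Finsupp.single (oflipCM c hc2 h'' T₀) (1 : ℤ) - Finsupp.single T₀ (1 : ℤ)) + (Finsupp.single (oflipCM c hc2 h'' T₁) (1 : ℤ) - Finsupp.single T₁ (1 : ℤ))) -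
          ((Finsupp.single (oflipCM c hc2 (h * g₁⁻¹) T₀) (1 : ℤ) - Finsupp.single T₀ (1 : ℤ)) - (Finsupp.single (oflipCM c hc2 (h * g₁⁻¹) T₁) (1 : ℤ) - Finsupp.single T₁ (1 : ℤ))) =
        (pair c (oflipCM c hc2 (h * g₁⁻¹) T₁) - pair c T₁) + (pair c (oflipCM c hc2 h'' T₁) - pair c T₁) -
        ((((Finsupp.single (oflipCM c hc2 (h * g₁⁻¹) T₀) (1 : ℤ) - Finsupp.single T₀ (1 : ℤ)) - (Finsupp.single (oflipCM c hc2 (h * g₁⁻¹) T₁) (1 : ℤ) - Finsupp.single T₁ (1 : ℤ))) + (pair c (oflipCM c hc2 (h * g₁⁻¹) T₁) - pair c T₁)) -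
          (((Finsupp.single (oflipCM c hc2 h'' T₀) (1 : ℤ) - Finsupp.single T₀ (1 : ℤ)) + (Finsupp.single (oflipCM c hc2 h'' T₁) (1 : ℤ) - Finsupp.single T₁ (1 : ℤ))) - (pair c (oflipCM c hc2 h'' T₁) - pair c T₁))) := by abel
    rw [e]; exact h2
  -- (r2) its translate by `g₁²`: `Y_{h''} − Y'_{κ₂}`
  have hgg₀ : rt c (g₁ * g₁) T₀ = T₀ := by rw [rt_mul, hg₀, hg₀]
  have hgg₁ : rt c (g₁ * g₁) T₁ = T₁ := by rw [rt_mul, hg₁, ← rt_mul, hcen g₁, rt_mul, hg₁, ← rt_mul, hc2, rt_one]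
  have r2 : ((Finsupp.single (oflipCM c hc2 h'' T₀) (1 : ℤ) - Finsupp.single T₀ (1 : ℤ)) + (Finsupp.single (oflipCM c hc2 h'' T₁) (1 : ℤ) - Finsupp.single T₁ (1 : ℤ))) -
        ((Finsupp.single (oflipCM c hc2 κ₂ T₀) (1 : ℤ) - Finsupp.single T₀ (1 : ℤ)) - (Finsupp.single (oflipCM c hc2 κ₂ T₁) (1 : ℤ) - Finsupp.single T₁ (1 : ℤ))) ∈ L := by
    have h1 := hLrt (g₁ * g₁) _ r1
    rw [Finsupp.mapDomain_sub, mapDomain_rt_Y_of_stab_stab c hc2 T₀ T₁ (g₁ * g₁) hgg₀ hgg₁,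
      mapDomain_rt_Y'_of_stab_stab c hc2 T₀ T₁ (g₁ * g₁) hgg₀ hgg₁, mul_inv_rev, ← mul_assoc, ← mul_assoc, hnorm T₀ hζh, hnorm T₁ hζh,
      hnorm T₀ hζκ, hnorm T₁ hζκ] at h1
    exact h1
  -- (r4) translate of (r1) by `Q`: `Y_{t₁} + Y'_{a₁}`
  have r4 : ((Finsupp.single (oflipCM c hc2 t₁ T₀) (1 : ℤ) - Finsupp.single T₀ (1 : ℤ)) + (Finsupp.single (oflipCM c hc2 t₁ T₁) (1 : ℤ) - Finsupp.single T₁ (1 : ℤ))) +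
        ((Finsupp.single (oflipCM c hc2 a₁ T₀) (1 : ℤ) - Finsupp.single T₀ (1 : ℤ)) - (Finsupp.single (oflipCM c hc2 a₁ T₁) (1 : ℤ) - Finsupp.single T₁ (1 : ℤ))) ∈ L := by
    have h1 := hLrt Q _ r1
    rw [Finsupp.mapDomain_sub, mapDomain_rt_Y_of_swap c hc2 T₀ T₁ Q hQ hQ₁, mapDomain_rt_Y'_of_swap c hc2 T₀ T₁ Q hQ hQ₁, sub_neg_eq_add,
      hnorm T₀ hσh, hnorm T₁ hσh, hnorm T₀ hσκ₁, hnorm T₁ hσκ₁] at h1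
    exact h1
  -- (r6) translate of (r3) by `Q`: `Y_{t₂} + Y'_{a₁}`
  have r6 : ((Finsupp.single (oflipCM c hc2 t₂ T₀) (1 : ℤ) - Finsupp.single T₀ (1 : ℤ)) + (Finsupp.single (oflipCM c hc2 t₂ T₁) (1 : ℤ) - Finsupp.single T₁ (1 : ℤ))) +
        ((Finsupp.single (oflipCM c hc2 a₁ T₀) (1 : ℤ) - Finsupp.single T₀ (1 : ℤ)) - (Finsupp.single (oflipCM c hc2 a₁ T₁) (1 : ℤ) - Finsupp.single T₁ (1 : ℤ))) ∈ L := by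
    have h1 := hLrt Q _ r3
    rw [Finsupp.mapDomain_sub, mapDomain_rt_Y_of_swap c hc2 T₀ T₁ Q hQ hQ₁, mapDomain_rt_Y'_of_swap c hc2 T₀ T₁ Q hQ hQ₁, sub_neg_eq_add,
      hnorm T₀ hσh'', hnorm T₁ hσh'', hnorm T₀ hσκ₁, hnorm T₁ hσκ₁] at h1
    exact h1
  -- (r5) translate of (r2) by `Q`: `Y_{t₂} + Y'_{a₂}`
  have r5 : ((Finsupp.single (oflipCM c hc2 t₂ T₀) (1 : ℤ) - Finsupp.single T₀ (1 : ℤ)) + (Finsupp.single (oflipCM c hc2 t₂ T₁) (1 : ℤ) - Finsupp.single T₁ (1 : ℤ))) +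
        ((Finsupp.single (oflipCM c hc2 a₂ T₀) (1 : ℤ) - Finsupp.single T₀ (1 : ℤ)) - (Finsupp.single (oflipCM c hc2 a₂ T₁) (1 : ℤ) - Finsupp.single T₁ (1 : ℤ))) ∈ L := by
    have h1 := hLrt Q _ r2
    rw [Finsupp.mapDomain_sub, mapDomain_rt_Y_of_swap c hc2 T₀ T₁ Q hQ hQ₁, mapDomain_rt_Y'_of_swap c hc2 T₀ T₁ Q hQ hQ₁, sub_neg_eq_add,
      hnorm T₀ hσh'', hnorm T₁ hσh'', hnorm T₀ hσκ₂, hnorm T₁ hσκ₂] at h1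
    exact h1
  -- (r7) the difference of the two transversal relations on `𝓗`
  have hTm : T.card = m := by rw [hTe, card_pair ht₁₂, hm]
  have hT'H : (T₀.1 \ T₁.1) \ T ⊆ T₀.1 \ T₁.1 := sdiff_subset
  have hT'm : ((T₀.1 \ T₁.1) \ T).card = m := by rw [card_sdiff_of_subset hTH, hH, hTm]; omega
  have hT' : ∀ t ∈ T₀.1 \ T₁.1, ∀ t' ∈ T₀.1, (t' = t * Q ∨ t' = c * (t * Q)) → (t ∈ (T₀.1 \ T₁.1) \ T ↔ t' ∉ (T₀.1 \ T₁.1) \ T) := by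
    intro t ht t' ht' htt'
    have ht'H : t' ∈ T₀.1 \ T₁.1 := (hσH t (mem_sdiff.mp ht).1 t' ht' htt').mp ht
    have key := hT t ht t' ht' htt'
    simp only [mem_sdiff]
    constructor
    · rintro ⟨-, htT⟩ ⟨-, ht'T⟩; exact htT (key.mpr ht'T)
    · intro hn'; exact ⟨mem_sdiff.mp ht, fun htT => hn' ⟨mem_sdiff.mp ht'H, key.mp htT⟩⟩
  have hRT := rel_transversal_mem' c hc2 hcen T₀ T₁ hbase m hn hH Q hQ hQ₁ hσH L hLrt hcover T hTH hTm hT hm2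
  have hRT' := rel_transversal_mem' c hc2 hcen T₀ T₁ hbase m hn hH Q hQ hQ₁ hσH L hLrt hcover ((T₀.1 \ T₁.1) \ T) hT'H hT'm hT' hm2
  have hTT : (T₀.1 \ T₁.1) \ ((T₀.1 \ T₁.1) \ T) = T := Finset.sdiff_sdiff_eq_self hTH
  have ht₁T : t₁ ∉ ({t₂} : Finset G) := by rw [mem_singleton]; exact ht₁₂
  have hhH : h ∉ ({h''} : Finset G) := by rw [mem_singleton]; exact hhh''
  have h21 : ((2 : ℕ) : ℤ) - 1 = 1 := by norm_num
  rw [hTT, hHe, hTe, sum_insert ht₁T, sum_singleton, sum_insert hhH, sum_singleton, hm, h21, one_smul] at hRT'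
  rw [hHe, hTe, sum_insert ht₁T, sum_singleton, sum_insert hhH, sum_singleton, hm, h21, one_smul] at hRT
  have r7 : ((Finsupp.single (oflipCM c hc2 t₁ T₀) (1 : ℤ) - Finsupp.single T₀ (1 : ℤ)) + (Finsupp.single (oflipCM c hc2 t₁ T₁) (1 : ℤ) - Finsupp.single T₁ (1 : ℤ))) +
        ((Finsupp.single (oflipCM c hc2 t₂ T₀) (1 : ℤ) - Finsupp.single T₀ (1 : ℤ)) + (Finsupp.single (oflipCM c hc2 t₂ T₁) (1 : ℤ) - Finsupp.single T₁ (1 : ℤ))) -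
        ((Finsupp.single (oflipCM c hc2 h T₀) (1 : ℤ) - Finsupp.single T₀ (1 : ℤ)) + (Finsupp.single (oflipCM c hc2 h T₁) (1 : ℤ) - Finsupp.single T₁ (1 : ℤ))) -
        ((Finsupp.single (oflipCM c hc2 h'' T₀) (1 : ℤ) - Finsupp.single T₀ (1 : ℤ)) + (Finsupp.single (oflipCM c hc2 h'' T₁) (1 : ℤ) - Finsupp.single T₁ (1 : ℤ))) ∈ L := by
    have e : ((Finsupp.single (oflipCM c hc2 t₁ T₀) (1 : ℤ) - Finsupp.single T₀ (1 : ℤ)) + (Finsupp.single (oflipCM c hc2 t₁ T₁) (1 : ℤ) - Finsupp.single T₁ (1 : ℤ))) +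
          ((Finsupp.single (oflipCM c hc2 t₂ T₀) (1 : ℤ) - Finsupp.single T₀ (1 : ℤ)) + (Finsupp.single (oflipCM c hc2 t₂ T₁) (1 : ℤ) - Finsupp.single T₁ (1 : ℤ))) -
          ((Finsupp.single (oflipCM c hc2 h T₀) (1 : ℤ) - Finsupp.single T₀ (1 : ℤ)) + (Finsupp.single (oflipCM c hc2 h T₁) (1 : ℤ) - Finsupp.single T₁ (1 : ℤ))) -
          ((Finsupp.single (oflipCM c hc2 h'' T₀) (1 : ℤ) - Finsupp.single T₀ (1 : ℤ)) + (Finsupp.single (oflipCM c hc2 h'' T₁) (1 : ℤ) - Finsupp.single T₁ (1 : ℤ))) =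
        (Finsupp.single (oflipCM c hc2 t₁ T₀) (1 : ℤ) + Finsupp.single (oflipCM c hc2 t₂ T₀) (1 : ℤ) - (Finsupp.single (oflipCM c hc2 h T₁) (1 : ℤ) + Finsupp.single (oflipCM c hc2 h'' T₁) (1 : ℤ)) -
              (Finsupp.single T₀ (1 : ℤ) - Finsupp.single T₁ (1 : ℤ))) -
        (Finsupp.single (oflipCM c hc2 h T₀) (1 : ℤ) + Finsupp.single (oflipCM c hc2 h'' T₀) (1 : ℤ) - (Finsupp.single (oflipCM c hc2 t₁ T₁) (1 : ℤ) + Finsupp.single (oflipCM c hc2 t₂ T₁) (1 : ℤ)) -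
              (Finsupp.single T₀ (1 : ℤ) - Finsupp.single T₁ (1 : ℤ))) := by
      abel
    rw [e]; exact Submodule.sub_mem _ hRT hRT'
  -- (r8) the difference of the two transversal relations on `𝓗ᶜ`
  have hAe' : A = {a₁, a₂} := by
    symm; apply eq_of_subset_of_card_le
    · intro x hx; rw [mem_insert, mem_singleton] at hx; rcases hx with rfl | rfl <;> assumption
    · rw [hAe, card_pair hkk'', card_pair ha₁₂]
  have hAm : A.card = m := by rw [hAe, card_pair hkk'', hm]
  have hIc : (T₀.1 ∩ T₁.1).card = 2 * m := by
    have h0 := card_sdiff_add_card_inter T₀.1 T₁.1; rw [hn, hH] at h0; omega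
  have hA'H : (T₀.1 ∩ T₁.1) \ A ⊆ T₀.1 ∩ T₁.1 := sdiff_subset
  have hA'm : ((T₀.1 ∩ T₁.1) \ A).card = m := by rw [card_sdiff_of_subset hA, hIc, hAm]; omega
  have hA'tr : ∀ t ∈ T₀.1 ∩ T₁.1, ∀ t' ∈ T₀.1, (t' = t * Q ∨ t' = c * (t * Q)) → (t ∈ (T₀.1 ∩ T₁.1) \ A ↔ t' ∉ (T₀.1 ∩ T₁.1) \ A) := by
    intro t ht t' ht' htt'
    have ht0 : t ∈ T₀.1 := (mem_inter.mp ht).1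
    have ht'I : t' ∈ T₀.1 ∩ T₁.1 := by
      refine mem_inter.mpr ⟨ht', ?_⟩
      by_contra h1
      have h2 : t' ∈ T₀.1 \ T₁.1 := mem_sdiff.mpr ⟨ht', h1⟩
      exact (mem_sdiff.mp ((hσH t ht0 t' ht' htt').mpr h2)).2 (mem_inter.mp ht).2
    have key := hAtr t ht t' ht' htt'
    simp only [mem_sdiff]
    constructor
    · rintro ⟨-, htA⟩ ⟨-, ht'A⟩; exact htA (key.mpr ht'A)
    · intro hn'; exact ⟨ht, fun htA => hn' ⟨ht'I, key.mp htA⟩⟩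
  have hRA := relc_mem' c hc2 hcen T₀ T₁ hbase m hn hH Q hQ hQ₁ hσH L hLrt hcover A hA hAm hAtr hP hm2
  have hRA' := relc_mem' c hc2 hcen T₀ T₁ hbase m hn hH Q hQ hQ₁ hσH L hLrt hcover ((T₀.1 ∩ T₁.1) \ A) hA'H hA'm hA'tr hP hm2
  have hAA : (T₀.1 ∩ T₁.1) \ ((T₀.1 ∩ T₁.1) \ A) = A := Finset.sdiff_sdiff_eq_self hA
  have ha₁s : a₁ ∉ ({a₂} : Finset G) := by rw [mem_singleton]; exact ha₁₂
  have hκs : h * g₁⁻¹ ∉ ({κ₂} : Finset G) := by rw [mem_singleton]; exact hκ₁₂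
  rw [hAA, hAce, hAe', sum_insert ha₁s, sum_singleton, sum_insert hκs, sum_singleton, hm, h21, one_smul] at hRA'
  rw [hAce, hAe', sum_insert ha₁s, sum_singleton, sum_insert hκs, sum_singleton, hm, h21, one_smul] at hRA
  have r8 : ((Finsupp.single (oflipCM c hc2 a₁ T₀) (1 : ℤ) - Finsupp.single T₀ (1 : ℤ)) - (Finsupp.single (oflipCM c hc2 a₁ T₁) (1 : ℤ) - Finsupp.single T₁ (1 : ℤ))) +
        ((Finsupp.single (oflipCM c hc2 a₂ T₀) (1 : ℤ) - Finsupp.single T₀ (1 : ℤ)) - (Finsupp.single (oflipCM c hc2 a₂ T₁) (1 : ℤ) - Finsupp.single T₁ (1 : ℤ))) -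
        ((Finsupp.single (oflipCM c hc2 (h * g₁⁻¹) T₀) (1 : ℤ) - Finsupp.single T₀ (1 : ℤ)) - (Finsupp.single (oflipCM c hc2 (h * g₁⁻¹) T₁) (1 : ℤ) - Finsupp.single T₁ (1 : ℤ))) -
        ((Finsupp.single (oflipCM c hc2 κ₂ T₀) (1 : ℤ) - Finsupp.single T₀ (1 : ℤ)) - (Finsupp.single (oflipCM c hc2 κ₂ T₁) (1 : ℤ) - Finsupp.single T₁ (1 : ℤ))) ∈ L := by
    have e : ((Finsupp.single (oflipCM c hc2 a₁ T₀) (1 : ℤ) - Finsupp.single T₀ (1 : ℤ)) - (Finsupp.single (oflipCM c hc2 a₁ T₁) (1 : ℤ) - Finsupp.single T₁ (1 : ℤ))) +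
          ((Finsupp.single (oflipCM c hc2 a₂ T₀) (1 : ℤ) - Finsupp.single T₀ (1 : ℤ)) - (Finsupp.single (oflipCM c hc2 a₂ T₁) (1 : ℤ) - Finsupp.single T₁ (1 : ℤ))) -
          ((Finsupp.single (oflipCM c hc2 (h * g₁⁻¹) T₀) (1 : ℤ) - Finsupp.single T₀ (1 : ℤ)) - (Finsupp.single (oflipCM c hc2 (h * g₁⁻¹) T₁) (1 : ℤ) - Finsupp.single T₁ (1 : ℤ))) -
          ((Finsupp.single (oflipCM c hc2 κ₂ T₀) (1 : ℤ) - Finsupp.single T₀ (1 : ℤ)) - (Finsupp.single (oflipCM c hc2 κ₂ T₁) (1 : ℤ) - Finsupp.single T₁ (1 : ℤ))) =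
        (Finsupp.single (oflipCM c hc2 a₁ T₀) (1 : ℤ) + Finsupp.single (oflipCM c hc2 a₂ T₀) (1 : ℤ) + (Finsupp.single (oflipCM c hc2 (h * g₁⁻¹) T₁) (1 : ℤ) + Finsupp.single (oflipCM c hc2 κ₂ T₁) (1 : ℤ)) - (Finsupp.single T₀ (1 : ℤ) + Finsupp.single T₁ (1 : ℤ))) -
        (Finsupp.single (oflipCM c hc2 (h * g₁⁻¹) T₀) (1 : ℤ) + Finsupp.single (oflipCM c hc2 κ₂ T₀) (1 : ℤ) + (Finsupp.single (oflipCM c hc2 a₁ T₁) (1 : ℤ) + Finsupp.single (oflipCM c hc2 a₂ T₁) (1 : ℤ)) - (Finsupp.single T₀ (1 : ℤ) + Finsupp.single T₁ (1 : ℤ))) := by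
      abel
    rw [e]; exact Submodule.sub_mem _ hRA hRA'
  -- the linear algebra: `4Y`, `4Y'`
  obtain ⟨h4Y, h4Y'⟩ := four_smul_mem_of_relations c hc2 T₀ T₁ L h h'' t₁ t₂ (h * g₁⁻¹) κ₂ a₁ a₂ r1 r2 r3 r4 r5 r6 r7 r8
  -- `𝓗 = {h, h'', t₁, t₂}`, `𝓗ᶜ = {κ₁, κ₂, a₁, a₂}`
  have hHeq : T₀.1 \ T₁.1 = {h, h'', t₁, t₂} := by
    have e : T₀.1 \ T₁.1 = ((T₀.1 \ T₁.1) \ T) ∪ T := (sdiff_union_of_subset hTH).symm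
    rw [e, hHe, hTe, insert_union, ← insert_eq]
  have hIeq : T₀.1 ∩ T₁.1 = {h * g₁⁻¹, κ₂, a₁, a₂} := by
    have e : T₀.1 ∩ T₁.1 = ((T₀.1 ∩ T₁.1) \ A) ∪ A := (sdiff_union_of_subset hA).symm
    rw [e, hAce, hAe', insert_union, ← insert_eq]
  refine residual_closure_frame_four c hc2 hc1 hcen T₀ T₁ hbase L hP m hH hIc (fun s hs => h4Y s (by rw [← hHeq]; exact hs))
    (fun s hs => h4Y' s (by rw [← hIeq]; exact hs)) ⟨T, hTH, hTm, ?_⟩ ⟨A, hA, hAm, ?_⟩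
  · exact rel_transversal_mem' c hc2 hcen T₀ T₁ hbase m hn hH Q hQ hQ₁ hσH L hLrt hcover T hTH hTm hT hm2
  · exact relc_mem' c hc2 hcen T₀ T₁ hbase m hn hH Q hQ hQ₁ hσH L hLrt hcover A hA hAm hAtr hP hm2

end Frame

end

end Summit.HodgeConjecture.CorCM.Census.CentralSquares
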